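import Summits.KontsevichZagierPeriods.KontsevichZagierPeriods.Theses.HurwitzMicroSectors
import Summits.KontsevichZagierPeriods.KontsevichZagierPeriods.Theorems.SectorTwoSix.Negative.LoadBearing
import Literature.NumberTheory.Transcendental.CalegariDimitrovTangL2Chi3

/-!
# `SectorTwoSix` (stmt-KontsevichZagierPeriods-3870, route HurwitzMicroSectors) — line
`jacobian-monomial-absorption`, stub `stub_rigid`

The rigidity step of the crux. After reduction, a numerator `P ∈ ℚ[t]` of the sector integrand
`P(x₀x₁)/(1 − (x₀x₁)⁶)` on the open box `(0,1)²` has the normal form `a(1 − t⁶) + b t³ + c t⁵`,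
whose value is `a + b·H₃ + c·H₅` with `H₃ = −L(2,χ₋₃)/8 + π²/54` and `H₅ = π²/216`. Under the
named fact of Calegari–Dimitrov–Tang (Theorem 1: `1, π², L(2,χ₋₃)` are `ℚ`-linearly independent,
taken here as the HYPOTHESIS `calegariDimitrovTang_linearIndependent`, never proved), equal values
of two normal forms force equal rational coefficients: the difference of the two sides is the
rational relation `p + q π² + r L(2,χ₋₃) = 0` with `p = a − a'`, `q = (b − b')/54 + (c − c')/216`,
`r = −(b − b')/8`, which is trivial by `calegariDimitrovTang_linearIndependent.eq_zero`; then
`b = b'` from `r = 0`, `c = c'` from `q = 0`, `a = a'` from `p = 0`.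

## References

* F. Calegari, V. Dimitrov, Y. Tang, *The linear independence of `1`, `ζ(2)`, and `L(2, χ₋₃)`*,
  arXiv:2408.15403 (2024), Theorem 1.
* M. Kontsevich, D. Zagier, *Periods* (2001), §1.2.
-/

noncomputable section

open Set MeasureTheory Polynomial
open Literature.NumberTheory.Transcendental
open Summit.KontsevichZagierPeriods.Theorems.SectorTwoSix.Negative

namespace Summit.KontsevichZagierPeriods.Theorems.HurwitzMicroSectorsSectorTwoSix

/-- **Rigidity under CDT** (registered stub `stub_rigid` of crux stmt-KontsevichZagierPeriods-3870).
`1, H₃, H₅` (`H₃ = −L(2,χ₋₃)/8 + π²/54`, `H₅ = π²/216`) are `ℚ`-independent as soon as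
`1, π², L(2,χ₋₃)` are, so equal values `a + bH₃ + cH₅ = a' + b'H₃ + c'H₅` of two normal forms with
rational coefficients force `a = a'`, `b = b'`, `c = c'`
(`calegariDimitrovTang_linearIndependent.eq_zero` applied to `p = a − a'`,
`q = (b − b')/54 + (c − c')/216`, `r = −(b − b')/8`). -/
theorem stub_rigid : calegariDimitrovTang_linearIndependent → ∀ a b c a' b' c' : ℚ,
    (a : ℝ) + b * (-(L2chi3 / 8) + Real.pi ^ 2 / 54) + c * (Real.pi ^ 2 / 216) =
      (a' : ℝ) + b' * (-(L2chi3 / 8) + Real.pi ^ 2 / 54) + c' * (Real.pi ^ 2 / 216) →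
    a = a' ∧ b = b' ∧ c = c' := by
  intro hCDT a b c a' b' c' h
  obtain ⟨h1, h2, h3⟩ := hCDT.eq_zero (a - a') ((b - b') / 54 + (c - c') / 216) (-((b - b') / 8))
    (by push_cast; linarith)
  have e2 : b = b' := by linarith
  have e3 : c = c' := by rw [e2, sub_self, zero_div, zero_add] at h2; linarith
  have e1 : a = a' := by linarith
  exact ⟨e1, e2, e3⟩

end Summit.KontsevichZagierPeriods.Theorems.HurwitzMicroSectorsSectorTwoSix
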